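import Summits.CriticalPhenomena.PercolationContinuityZ3.Theorems.Transplant.FKConnectivityAllQUniformLevelGluing
import Summits.CriticalPhenomena.PercolationContinuityZ3.Theorems.Transplant.FKConnectivityAllQGluing
import Summits.CriticalPhenomena.PercolationContinuityZ3.Theorems.PercNearOneGluingNoHeavyLowerTailFKExactEval
import HarnessLib

/-!
# MIXED-RELAY LEVELWISE GLUING — the exact equivalent of 'additive gluing under every count weight', its reduction, and the
# kernel REFUTATION of the pure uniform-relay node `UniformLevelGluingPos` at `n = 7` (ERRATUM to `…UniformLevelGluing`)

Support file (`--supports stmt-CriticalPhenomena-4575`), FK sub-lane `prim-bschramm-fk-1` (gen 11) of the post-continuity programme;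
builds on p205010 (kernel theorem, internal audit signed; external expert review pending).  Definitions (`MixedLevelGluingOn`, the
`@[conjecture]` node `MixedLevelGluingPos` — NOT asserted; one `abbrev` + three `def`s for the certificate), no named facts, no sorries;
standard axioms (`decide +kernel` for four finite masses).  Nothing here bears on p205010.

ERRATUM (same seat, same day, kit j132384 finished after `…UniformLevelGluing` was filed): the evidence sentence of `UniformLevelGluingPos`
('sparse n = 7: 0 failures') is WRONG.  The PURE uniform-relay statement (one relay `a*` dominating the gluing defect at every
cluster-count level) holds in every cell on `≤ 6` vertices (n = 4 palette-exhaustive 1,411,788 placements; n = 5: 240,000 + 264,000;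
n = 6: 495,000 + 8,250; 0 failures) but FAILS at `n = 7`: 167 of 1,310,400 placements on 1,200 random sparse 7-vertex graphs — kernel
certificate **`not_uniformLevelGluingPos`** below (the unicyclic graph `02, 05, 06, 13, 15, 23, 46` with parameters
`(1, 4, 8, 2, 9, 4, 6)/10`, source `5`, target `2`, relays `{0, 1}`: relay `0` fails at level `3` (`P(E, k=3) = 84933/312500 > 83772/312500 =
P(0 ↮ 2, k=3)`), relay `1` at level `2` (`P(E, k=2) = 6345/78125 > 6303/78125 = P(1 ↮ 2, k=2)`)).  In ALL 167 cases the MIXED form holds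
(a probability vector `λ` on `A` with `Σ_a λ_a P(a ↮ b, k=j) ≥ P(E, k=j)` for every `j`; there `λ_0 ∈ [0.069, 0.313]`), and the mixed form
is, by LP duality / von Neumann's minimax over (`h ≥ 0` normalised, `λ ∈ Δ(A)`), EQUIVALENT to 'additive gluing `μ_h(E) ≤ max_a μ_h(a ↮ b)`
for every count weight `h ≥ 0`' — i.e. exactly the content of the census tables behind `AdditiveGluingCountPos` (fk-1 g9/g10, cp-hp5),
which therefore stand unrefuted through n = 7.  This file files the mixed node and proves the easy direction of the equivalence:
* `MixedLevelGluingOn V`, `@[conjecture] MixedLevelGluingPos`; `mixedLevelGluingOn_of_uniform` (pure ⇒ mixed);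
* **`additiveGluingUnder_crMeasure_of_mixedLevel`**, **`additiveGluingCountPos_of_mixedLevelGluingPos`** (mixed ⇒ additive gluing under
  every positive count weight: `μ_h(E)·Z = Σ_j h(j) P(E ∩ L_j) ≤ Σ_a λ_a μ_h(a ↮ b)·Z ≤ t·Z`);
* **`not_uniformLevelGluingOn_fin_seven`**, **`not_uniformLevelGluingPos`** (the certificate; `P_w = φ_{w,1}` by `rcMeasureW_one`, masses
  by fk-3's `RCEval` evaluator).
[cite: KozmaNitzan2024, Conj. 1 (p. 3); Thm. 1 (p. 7)] [cite: Grimmett2006, §1.4 eq. (1.20) (p. 15); §1.2 (p. 4)]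
-/

noncomputable section

namespace Summit.CriticalPhenomena.PercolationContinuityZ3.Theorems

namespace FK

open MeasureTheory Set Literature.Probability.LatticeModels Literature.Probability.Percolation
open Literature.Probability.Percolation.DecisionTree (ind ind_of_mem ind_of_not_mem ind_nonneg)
open scoped Classical

variable {V : Type*} [Fintype V]

/-! ### The mixed node -/

/-- **Mixed-relay levelwise gluing on `V`** (ML-AG): for all weights `w`, non-empty relay sets `A`, source `o`, target `b` there is a
probability vector `λ` on `A` with `P_w(E ∩ L_j) ≤ Σ_{a ∈ A} λ_a · P_w({a ↮ b} ∩ L_j)` for EVERY level `j`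
(`E = {o ↔ A} ∖ {o ↔ b}`, `L_j = {k = j}`). [cite: KozmaNitzan2024, Conj. 1 (p. 3)] [cite: Grimmett2006, §1.2 eq. (1.1) (p. 4)] -/
def MixedLevelGluingOn (V : Type*) [Fintype V] : Prop :=
  ∀ (w : Sym2 V → unitInterval) (A : Finset V) (o b : V), A.Nonempty →
    ∃ lam : V → ℝ, (∀ a, 0 ≤ lam a) ∧ (∑ a ∈ A, lam a = 1) ∧ ∀ j : ℕ,
      (prodBernoulli w).real (((⋃ x ∈ A, openConn o x) \ openConn o b) ∩ levelSet V j) ≤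
        ∑ a ∈ A, lam a * (prodBernoulli w).real ((openConn a b)ᶜ ∩ levelSet V j)

/-- **Mixed-relay levelwise gluing on every finite weighted graph** — equivalently (minimax), additive gluing under EVERY count weight
`h ≥ 0`.  CONJECTURE-SHAPED STATEMENT, NOT asserted.  Evidence (fk-1 g11, exact, 2026-08-21): every cell on `≤ 6` vertices even in the
pure form; n = 7 sparse (kit j132384): 1,310,400 placements, 0 failures of the mixed form (167 of the pure form).
[cite: KozmaNitzan2024, Conj. 1 (p. 3); Thm. 1 (p. 7)] -/
@[conjecture] def MixedLevelGluingPos : Prop := ∀ n : ℕ, MixedLevelGluingOn (Fin n)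

/-- **Pure ⇒ mixed** (take `λ` = the indicator of the dominating relay). [folklore] -/
theorem mixedLevelGluingOn_of_uniform (hU : UniformLevelGluingOn V) : MixedLevelGluingOn V := by
  intro w A o b hA
  obtain ⟨a, haA, hlev⟩ := hU w A o b hA
  refine ⟨fun x => if x = a then 1 else 0, fun x => by positivity, by simp [Finset.sum_ite_eq', haA], fun j => ?_⟩
  dsimp only
  rw [Finset.sum_eq_single_of_mem a haA (fun x _ hx => by rw [if_neg hx, zero_mul]), if_pos rfl, one_mul]
  exact hlev j

/-! ### Mixed ⇒ additive gluing under every positive count weight -/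

/-- **Additive gluing under `μ_{w,h}` from mixed-relay levelwise gluing** (every positive `h`): `μ_h(E) ≤ Σ_a λ_a μ_h(a ↮ b) ≤ t`.
[cite: KozmaNitzan2024, Conj. 1 (p. 3)] [cite: Grimmett2006, §1.4 eq. (1.20) (p. 15)] -/
theorem additiveGluingUnder_crMeasure_of_mixedLevel (hM : MixedLevelGluingOn V) (w : Sym2 V → unitInterval) {h : ℕ → ℝ}
    (hpos : ∀ k, 0 < h k) (A : Finset V) (o b : V) : AdditiveGluingUnder (crMeasure w h) A o b := by
  haveI := isProbabilityMeasure_crMeasure w hpos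
  intro t ht hAt
  have hunion : (crMeasure w h).real (⋃ x ∈ A, openConn o x) ≤
      (crMeasure w h).real (openConn o b) + (crMeasure w h).real ((⋃ x ∈ A, openConn o x) \ openConn o b) :=
    (measureReal_mono (iUnion_subset_union_diff A o b)).trans (measureReal_union_le _ _)
  by_cases hne : A.Nonempty
  · obtain ⟨lam, hlam0, hlam1, hlev⟩ := hM w A o b hne
    have hZ := crPartition_pos w hpos
    -- `μ(E)·Z ≤ (Σ_a λ_a μ(a ↮ b))·Z`, level by level
    have hEZ : (crMeasure w h).real ((⋃ x ∈ A, openConn o x) \ openConn o b) * crPartition w h ≤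
        (∑ a ∈ A, lam a * (crMeasure w h).real (openConn a b)ᶜ) * crPartition w h := by
      have hrhs : (∑ a ∈ A, lam a * (crMeasure w h).real (openConn a b)ᶜ) * crPartition w h =
          ∑ j ∈ Finset.range (Fintype.card V + 1),
            h j * ∑ a ∈ A, lam a * (prodBernoulli w).real ((openConn a b)ᶜ ∩ levelSet V j) := by
        rw [Finset.sum_mul]
        have h2 : ∀ a ∈ A, lam a * (crMeasure w h).real (openConn a b)ᶜ * crPartition w h =
            ∑ j ∈ Finset.range (Fintype.card V + 1), h j * (lam a * (prodBernoulli w).real ((openConn a b)ᶜ ∩ levelSet V j)) := by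
          intro a _
          rw [mul_assoc, crMeasure_real_mul_eq_sum_levels w hpos, Finset.mul_sum]
          exact Finset.sum_congr rfl fun j _ => by ring
        rw [Finset.sum_congr rfl h2, Finset.sum_comm]
        exact Finset.sum_congr rfl fun j _ => by rw [Finset.mul_sum]
      rw [hrhs, crMeasure_real_mul_eq_sum_levels w hpos]
      exact Finset.sum_le_sum fun j _ => mul_le_mul_of_nonneg_left (hlev j) (hpos j).le
    have hEle : (crMeasure w h).real ((⋃ x ∈ A, openConn o x) \ openConn o b) ≤
        ∑ a ∈ A, lam a * (crMeasure w h).real (openConn a b)ᶜ := le_of_mul_le_mul_right hEZ hZ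
    -- each `μ(a ↮ b) ≤ t`
    have hcompl : ∀ a ∈ A, (crMeasure w h).real (openConn a b)ᶜ ≤ t := by
      intro a haA
      have hms : MeasurableSet (openConn a b : Set (BondConfig V)) := measurableSet_bond _
      rw [probReal_compl_eq_one_sub hms]
      linarith [hAt a haA]
    have hsum : ∑ a ∈ A, lam a * (crMeasure w h).real (openConn a b)ᶜ ≤ ∑ a ∈ A, lam a * t :=
      Finset.sum_le_sum fun a haA => mul_le_mul_of_nonneg_left (hcompl a haA) (hlam0 a)
    rw [← Finset.sum_mul, hlam1, one_mul] at hsum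
    linarith
  · rw [Finset.not_nonempty_iff_eq_empty] at hne
    subst hne
    have h0 : (crMeasure w h).real (⋃ x ∈ (∅ : Finset V), (openConn o x : Set (BondConfig V))) = 0 := by simp
    rw [h0]
    linarith [measureReal_nonneg (μ := crMeasure w h) (s := openConn o b)]

/-- **`MixedLevelGluingPos → AdditiveGluingCountPos`.** [cite: KozmaNitzan2024, Conj. 1 (p. 3)] [cite: Grimmett2006, §3.9 (pp. 63–65)] -/
theorem additiveGluingCountPos_of_mixedLevelGluingPos (hM : MixedLevelGluingPos) : AdditiveGluingCountPos :=
  fun n w _ hpos A o b => additiveGluingUnder_crMeasure_of_mixedLevel (hM n) w hpos A o b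

/-- **`MixedLevelGluingPos → FK.AdditiveGluingFKPos`** (all `q > 0`). [cite: KozmaNitzan2024, Conj. 1 (p. 3)] -/
theorem additiveGluingFKPos_of_mixedLevelGluingPos (hM : MixedLevelGluingPos) : AdditiveGluingFKPos :=
  additiveGluingFKPos_of_countPos (additiveGluingCountPos_of_mixedLevelGluingPos hM)

/-! ### The pure uniform-relay node fails at `n = 7` (kernel certificate) -/

namespace UniformLevelCex

/-- The unicyclic graph on `Fin 7` with pairs `02, 05, 06, 13, 15, 23, 46` and parameters `(1, 4, 8, 2, 9, 4, 6)/10`; `q = 1`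
(product measure). [cite: Grimmett2006, §1.4 eq. (1.20) (p. 15)] -/
abbrev d7 : RCEval :=
  ⟨7, 7, ![0, 0, 0, 1, 1, 2, 4], ![2, 5, 6, 3, 5, 3, 6], ![1 / 10, 2 / 5, 4 / 5, 1 / 5, 9 / 10, 2 / 5, 3 / 5], 1⟩

/-- Validity of the data set. [folklore] -/
theorem valid : d7.Valid := by decide +kernel

/-- Computable predicate of the gluing defect `E = ({5 ↔ 0} ∪ {5 ↔ 1}) ∖ {5 ↔ 2}` at level `j`. [folklore] -/
def pE (j : ℕ) (t : Finset (Fin 7)) : Bool := ((d7.reachB t 5 0 || d7.reachB t 5 1) && !(d7.reachB t 5 2)) && decide (d7.kB t = j)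

/-- Computable predicate of `{a ↮ 2}` at level `j`. [folklore] -/
def pF (a : Fin 7) (j : ℕ) (t : Finset (Fin 7)) : Bool := !(d7.reachB t a 2) && decide (d7.kB t = j)

/-- `P(E, k = 3) = 84933/312500`. [cite: Grimmett2006, §1.4 eq. (1.20) (p. 15)] -/
theorem mE3 : d7.massQ (pE 3) = 84933 / 312500 := by decide +kernel
/-- `P(0 ↮ 2, k = 3) = 20943/78125`. [cite: Grimmett2006, §1.4 eq. (1.20) (p. 15)] -/
theorem mF03 : d7.massQ (pF 0 3) = 20943 / 78125 := by decide +kernel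
/-- `P(E, k = 2) = 1269/15625`. [cite: Grimmett2006, §1.4 eq. (1.20) (p. 15)] -/
theorem mE2 : d7.massQ (pE 2) = 1269 / 15625 := by decide +kernel
/-- `P(1 ↮ 2, k = 2) = 6303/78125`. [cite: Grimmett2006, §1.4 eq. (1.20) (p. 15)] -/
theorem mF12 : d7.massQ (pF 1 2) = 6303 / 78125 := by decide +kernel

/-- `conf t ∈ E ∩ L_j` iff `pE j`. [folklore] -/
theorem mem_E_iff (j : ℕ) (t : Finset (Fin 7)) :
    d7.conf t ∈ ((⋃ x ∈ ({0, 1} : Finset (Fin 7)), openConn (5 : Fin 7) x) \ openConn (5 : Fin 7) 2) ∩ levelSet (Fin 7) j ↔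
      pE j t = true := by
  rw [Set.mem_inter_iff, mem_levelSet_iff, RCEval.clusterCount_conf]
  unfold pE
  simp only [Set.mem_sdiff, Set.mem_iUnion, Finset.mem_insert, Finset.mem_singleton, exists_prop,
    Bool.and_eq_true, Bool.or_eq_true, Bool.not_eq_true', Bool.eq_false_iff, ne_eq,
    RCEval.reachB_iff, decide_eq_true_eq, mem_openConn_iff']
  constructor
  · rintro ⟨⟨⟨x, hx, hr⟩, hnot⟩, hk⟩
    refine ⟨⟨?_, hnot⟩, hk⟩
    rcases hx with rfl | rfl
    · exact Or.inl hr
    · exact Or.inr hr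
  · rintro ⟨⟨hor, hnot⟩, hk⟩
    refine ⟨⟨?_, hnot⟩, hk⟩
    rcases hor with h | h
    · exact ⟨0, Or.inl rfl, h⟩
    · exact ⟨1, Or.inr rfl, h⟩

/-- `conf t ∈ {a ↮ 2} ∩ L_j` iff `pF a j`. [folklore] -/
theorem mem_F_iff (a : Fin 7) (j : ℕ) (t : Finset (Fin 7)) :
    d7.conf t ∈ (openConn a (2 : Fin 7))ᶜ ∩ levelSet (Fin 7) j ↔ pF a j t = true := by
  rw [Set.mem_inter_iff, mem_levelSet_iff, RCEval.clusterCount_conf]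
  unfold pF
  simp only [Set.mem_compl_iff, Bool.and_eq_true, Bool.not_eq_true', Bool.eq_false_iff, ne_eq, RCEval.reachB_iff,
    decide_eq_true_eq, mem_openConn_iff']

/-- The product measure of the data set as an `RCEval` measure (`q = 1`). [cite: Grimmett2006, §1.2 (p. 4)] -/
theorem prodBernoulli_eq : prodBernoulli d7.w = rcMeasureW d7.w ((d7.q : ℚ) : ℝ) ∅ := by
  rw [show ((d7.q : ℚ) : ℝ) = 1 by norm_num, rcMeasureW_one]

end UniformLevelCex

open UniformLevelCex

/-- **The pure uniform-relay statement fails on `Fin 7`: `¬ UniformLevelGluingOn (Fin 7)`.**  Witness: the unicyclic graph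
`02, 05, 06, 13, 15, 23, 46`, parameters `(1,4,8,2,9,4,6)/10`, source `5`, target `2`, relays `A = {0, 1}`: relay `0` fails at level `3`,
relay `1` at level `2`.  (refuted-substantive for the pure node; the mixed node `MixedLevelGluingPos` survives — there `λ_0 ∈ [0.069, 0.313]`.)
[cite: KozmaNitzan2024, Conj. 1 (p. 3)] [cite: Grimmett2006, §1.4 eq. (1.20) (p. 15)] -/
theorem not_uniformLevelGluingOn_fin_seven : ¬ UniformLevelGluingOn (Fin 7) := by
  intro hU
  obtain ⟨a, haA, hlev⟩ := hU d7.w ({0, 1} : Finset (Fin 7)) 5 2 ⟨0, by simp⟩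
  have hZ : (0 : ℝ) < (d7.ZQ : ℝ) := RCEval.zQ_pos valid
  simp only [Finset.mem_insert, Finset.mem_singleton] at haA
  rcases haA with rfl | rfl
  · have key := hlev 3
    rw [prodBernoulli_eq, RCEval.real_eq_massQ_div valid (P := pE 3) (mem_E_iff 3),
      RCEval.real_eq_massQ_div valid (P := pF 0 3) (mem_F_iff 0 3), mE3, mF03] at key
    have key' : ((84933 / 312500 : ℚ) : ℝ) / (d7.ZQ : ℝ) ≤ ((20943 / 78125 : ℚ) : ℝ) / (d7.ZQ : ℝ) := by
      push_cast at key ⊢; exact key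
    rw [div_le_div_iff_of_pos_right hZ] at key'
    norm_num at key'
  · have key := hlev 2
    rw [prodBernoulli_eq, RCEval.real_eq_massQ_div valid (P := pE 2) (mem_E_iff 2),
      RCEval.real_eq_massQ_div valid (P := pF 1 2) (mem_F_iff 1 2), mE2, mF12] at key
    have key' : ((1269 / 15625 : ℚ) : ℝ) / (d7.ZQ : ℝ) ≤ ((6303 / 78125 : ℚ) : ℝ) / (d7.ZQ : ℝ) := by
      push_cast at key ⊢; exact key
    rw [div_le_div_iff_of_pos_right hZ] at key'
    norm_num at key'

/-- **`¬ UniformLevelGluingPos`** — ERRATUM to the evidence line of that node ('sparse n = 7: 0 failures' was written before kit j132384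
finished): the pure form fails at `n = 7`; the mixed form `MixedLevelGluingPos` is the surviving statement (0 / 1,310,400 at n = 7).
[cite: KozmaNitzan2024, Conj. 1 (p. 3)] -/
theorem not_uniformLevelGluingPos : ¬ UniformLevelGluingPos := fun h => not_uniformLevelGluingOn_fin_seven (h 7)

end FK

end Summit.CriticalPhenomena.PercolationContinuityZ3.Theorems

end
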